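import Literature.NumberTheory.Automorphic.AdelicMatrixPoisson
import HarnessLib

/-!
# Row vectors times `GL_n(𝔸_K)`: Schwartz–Bruhat stability, the module `|det g|_𝔸`, and the
Fourier transform of `x ↦ Φ(x g)`

Topic `NumberTheory/Automorphic`; namespace `Literature.NumberTheory.Automorphic`. Proof file
(definitions of the obvious homeomorphisms, theorems; no named fact). The vector companion of
`AdelicMatrixPoisson` (which treats the two-sided twists `X ↦ A X B` of `M_n(𝔸_K)`): the right
action `x ↦ x g` of `g ∈ GL_n(𝔸_K)` on row vectors `x ∈ 𝔸_Kⁿ`, as it enters the mirabolic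
Eisenstein series `E(g, Φ; s) = |det g|^s ∑_ξ ∫ Φ(a ξ g) |a|^{ns} d^×a` (`MirabolicEisensteinSeries`;
Jacquet–Shalika (1981), §4; Cogdell (2004), §2.3) and its theta function
`Θ_Φ(a, g) = ∑_{ξ ∈ Kⁿ} Φ(a ξ g)`, to which the Poisson summation formula is applied in the variable
`ξ` (Jacquet–Shalika (1981), §4; Tate's thesis for `n = 1`; Godement–Jacquet, LNM 260, §11 for matrices):

* `piArch_vecMul`, `piFinite_vecMul` — archimedean and finite coordinates of `x g`;
  `vecArchCLE` (the real-linear automorphism `y ↦ y g_∞` of `(K ⊗ ℝ)ⁿ`), `vecFinHomeomorph`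
  (`y ↦ y g_f` on `(𝔸_K^∞)ⁿ`), `vecMulAddEquiv g` (**`x ↦ x g` as an isomorphism of topological
  additive groups of `𝔸_Kⁿ`**);
* `IsFactorizablePiSchwartzBruhat.comp_vecMul`, **`comp_vecMul_mem_piSchwartzBruhat`** —
  `𝒮(𝔸_Kⁿ) = piSchwartzBruhat K (Fin n)` is stable under `Φ ↦ Φ(· g)`; the scalar case
  `comp_smul_mem_piSchwartzBruhat` (`Φ ↦ Φ(a ·)`, `a ∈ 𝔸_Kˣ`);
* **`map_vecMul_eq_smul`** — for every additive Haar measure `ν` on `𝔸_Kⁿ`,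
  `(x ↦ x g)_* ν = |det g|_𝔸⁻¹ ν`, i.e. **the module of `x ↦ x g` on `𝔸_Kⁿ` is `|det g|_𝔸`**
  (Weil, *Basic Number Theory*, Ch. IV §3, Cor. 1 of Prop. 3). Proof by the *rows trick*: on
  `M_n(𝔸_K) = (𝔸_Kⁿ)ⁿ` with the product measure `ν^{⊗n}`, right multiplication by `g` acts row by
  row, so its module is the `n`-th power of the module `c` of `x ↦ x g`; but it is `|det g|_𝔸ⁿ`
  (`addHaar_matrix_op_smul_eq`, `MatrixAdeleModule`), whence `c = |det g|_𝔸`;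
* `integral_comp_vecMul` (`∫ Φ(x g) dν = |det g|_𝔸⁻¹ ∫ Φ dν`), `integrable_comp_vecMul_iff`,
  **`adelicPiFourier_comp_vecMul`** (`(Φ(· g))^(η) = |det g|_𝔸⁻¹ Φ̂(g⁻¹ η)`, `η` a column
  vector for the pairing `∑ η_i v_i` of `adelicPiFourier`), and the scalar cases
  `integral_comp_smul` (`∫ Φ(a x) dν = |a|^{-n} ∫ Φ`), `adelicPiFourier_comp_smul`
  (`(Φ(a ·))^(η) = |a|^{-n} Φ̂(a⁻¹ η)`) — Tate's `f(𝔞 𝔵) ↦ |𝔞|⁻¹ f̂(𝔵/𝔞)` in `n` variables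
  (Cassels–Fröhlich, Ch. XV, Thm. 4.2.1 "If we replace `f(x)` by `f(αx)` (`α` an idèle) we obtain …
  the Riemann–Roch theorem", PDF p. 360).

## References

* A. Weil, *Basic Number Theory* (1967), Ch. IV §3, Prop. 3 and Cor. 1 [WeilBNT1967].
* J. Tate, in Cassels–Fröhlich (eds.), *Algebraic Number Theory* (1967), Ch. XV, §4.2
  [CasselsFrohlichANT1967].
* H. Jacquet, J. A. Shalika, *On Euler products and the classification of automorphic
  representations I*, Amer. J. Math. 103 (1981), §4 [JacquetShalikaAJM1981].
* R. Godement, H. Jacquet, *Zeta functions of simple algebras*, LNM 260 (1972), §11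
  [GodementJacquetLNM260].
-/

noncomputable section

open scoped NNReal ENNReal Matrix Classical Pointwise RestrictedProduct
open NumberField NumberField.mixedEmbedding IsDedekindDomain MeasureTheory Measure Matrix Filter

namespace Literature.NumberTheory.Automorphic

/-! ### Coordinates of `x g` and the three equivalences -/

section Parts

variable {n : ℕ} {K : Type} [Field K] [NumberField K]

/-- `piArch v = archHom ∘ v` (definitional). [folklore] -/
theorem piArch_eq_comp (v : Fin n → AdeleRing (𝓞 K) K) : piArch K (Fin n) v = archHom K ∘ v := rfl

/-- **Archimedean coordinates of `x g`**: `(x g)_∞ = x_∞ g_∞`. [folklore] -/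
theorem piArch_vecMul (x : Fin n → AdeleRing (𝓞 K) K) (M : Matrix (Fin n) (Fin n) (AdeleRing (𝓞 K) K)) :
    piArch K (Fin n) (x ᵥ* M) = piArch K (Fin n) x ᵥ* M.map (archHom K) := by
  funext j
  rw [piArch_eq_comp, Function.comp_apply, RingHom.map_vecMul]
  rfl

/-- **Finite coordinates of `x g`**: `(x g)_f = x_f g_f`. [folklore] -/
theorem piFinite_vecMul (x : Fin n → AdeleRing (𝓞 K) K) (M : Matrix (Fin n) (Fin n) (AdeleRing (𝓞 K) K)) :
    piFinite K (Fin n) (x ᵥ* M) =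
      piFinite K (Fin n) x ᵥ* M.map (RingHom.snd (InfiniteAdeleRing K) (FiniteAdeleRing (𝓞 K) K)) := by
  funext j
  simp only [piFinite_apply, Matrix.vecMul, dotProduct, Matrix.map_apply]
  rw [AdeleRing.snd_sum]
  rfl

variable (n K) in
/-- **Right multiplication by an archimedean unit as a continuous real-linear automorphism** of
`(K ⊗ ℝ)ⁿ`: `y ↦ y U`. [folklore] -/
def vecArchCLE (U : (Matrix (Fin n) (Fin n) (mixedSpace K))ˣ) :
    (Fin n → mixedSpace K) ≃L[ℝ] (Fin n → mixedSpace K) :=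
  LinearEquiv.toContinuousLinearEquiv
    { toFun := fun y => y ᵥ* (U : Matrix (Fin n) (Fin n) (mixedSpace K))
      invFun := fun y => y ᵥ* ((U⁻¹ : (Matrix (Fin n) (Fin n) (mixedSpace K))ˣ) : Matrix (Fin n) (Fin n) (mixedSpace K))
      map_add' := fun y z => Matrix.add_vecMul _ y z
      map_smul' := fun c y => by
        rw [Matrix.smul_vecMul, RingHom.id_apply]
      left_inv := fun y => by
        change (y ᵥ* (U : Matrix (Fin n) (Fin n) (mixedSpace K))) ᵥ*
          ((U⁻¹ : (Matrix (Fin n) (Fin n) (mixedSpace K))ˣ) : Matrix (Fin n) (Fin n) (mixedSpace K)) = y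
        rw [Matrix.vecMul_vecMul, Units.mul_inv, Matrix.vecMul_one]
      right_inv := fun y => by
        change (y ᵥ* ((U⁻¹ : (Matrix (Fin n) (Fin n) (mixedSpace K))ˣ) : Matrix (Fin n) (Fin n) (mixedSpace K))) ᵥ*
          (U : Matrix (Fin n) (Fin n) (mixedSpace K)) = y
        rw [Matrix.vecMul_vecMul, Units.inv_mul, Matrix.vecMul_one] }

/-- Unfolding of `vecArchCLE`. [folklore] -/
theorem vecArchCLE_apply (U : (Matrix (Fin n) (Fin n) (mixedSpace K))ˣ) (y : Fin n → mixedSpace K) :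
    vecArchCLE n K U y = y ᵥ* (U : Matrix (Fin n) (Fin n) (mixedSpace K)) := rfl

/-- **Right multiplication by a finite-adelic unit is a homeomorphism of `(𝔸_K^∞)ⁿ`**. [folklore] -/
def vecFinHomeomorph (U : GL (Fin n) (FiniteAdeleRing (𝓞 K) K)) :
    (Fin n → FiniteAdeleRing (𝓞 K) K) ≃ₜ (Fin n → FiniteAdeleRing (𝓞 K) K) where
  toFun y := y ᵥ* (U : Matrix (Fin n) (Fin n) (FiniteAdeleRing (𝓞 K) K))
  invFun y := y ᵥ* ((U⁻¹ : GL (Fin n) (FiniteAdeleRing (𝓞 K) K)) : Matrix (Fin n) (Fin n) (FiniteAdeleRing (𝓞 K) K))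
  left_inv y := by
    simp only
    rw [Matrix.vecMul_vecMul, ← Matrix.GeneralLinearGroup.coe_mul, mul_inv_cancel,
      Matrix.GeneralLinearGroup.coe_one, Matrix.vecMul_one]
  right_inv y := by
    simp only
    rw [Matrix.vecMul_vecMul, ← Matrix.GeneralLinearGroup.coe_mul, inv_mul_cancel,
      Matrix.GeneralLinearGroup.coe_one, Matrix.vecMul_one]
  continuous_toFun := continuous_id.matrix_vecMul continuous_const
  continuous_invFun := continuous_id.matrix_vecMul continuous_const

/-- **`x ↦ x g` as an isomorphism of topological additive groups of `𝔸_Kⁿ`**, `g ∈ GL_n(𝔸_K)`.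
[folklore] -/
def vecMulAddEquiv (g : GL (Fin n) (AdeleRing (𝓞 K) K)) :
    (Fin n → AdeleRing (𝓞 K) K) ≃ₜ+ (Fin n → AdeleRing (𝓞 K) K) where
  toFun x := x ᵥ* (g : Matrix (Fin n) (Fin n) (AdeleRing (𝓞 K) K))
  invFun x := x ᵥ* ((g⁻¹ : GL (Fin n) (AdeleRing (𝓞 K) K)) : Matrix (Fin n) (Fin n) (AdeleRing (𝓞 K) K))
  left_inv x := by
    simp only
    rw [Matrix.vecMul_vecMul, ← Matrix.GeneralLinearGroup.coe_mul, mul_inv_cancel,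
      Matrix.GeneralLinearGroup.coe_one, Matrix.vecMul_one]
  right_inv x := by
    simp only
    rw [Matrix.vecMul_vecMul, ← Matrix.GeneralLinearGroup.coe_mul, inv_mul_cancel,
      Matrix.GeneralLinearGroup.coe_one, Matrix.vecMul_one]
  map_add' x y := Matrix.add_vecMul _ x y
  continuous_toFun := continuous_id.matrix_vecMul continuous_const
  continuous_invFun := continuous_id.matrix_vecMul continuous_const

/-- Unfolding of `vecMulAddEquiv`. [folklore] -/
@[simp]
theorem vecMulAddEquiv_apply (g : GL (Fin n) (AdeleRing (𝓞 K) K)) (x : Fin n → AdeleRing (𝓞 K) K) :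
    vecMulAddEquiv g x = x ᵥ* (g : Matrix (Fin n) (Fin n) (AdeleRing (𝓞 K) K)) := rfl

/-- The inverse of `vecMulAddEquiv g` is `vecMulAddEquiv g⁻¹`. [folklore] -/
theorem vecMulAddEquiv_symm_apply (g : GL (Fin n) (AdeleRing (𝓞 K) K)) (x : Fin n → AdeleRing (𝓞 K) K) :
    (vecMulAddEquiv g).symm x = x ᵥ* ((g⁻¹ : GL (Fin n) (AdeleRing (𝓞 K) K)) : Matrix (Fin n) (Fin n) (AdeleRing (𝓞 K) K)) :=
  rfl

/-- Multiplication of a vector by a scalar idele `a` is `x ↦ x · (a 1_n)`. [folklore] -/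
theorem units_smul_eq_vecMul_scalar (a : (AdeleRing (𝓞 K) K)ˣ) (x : Fin n → AdeleRing (𝓞 K) K) :
    (a : AdeleRing (𝓞 K) K) • x =
      x ᵥ* ((Matrix.GeneralLinearGroup.scalar (Fin n) a : GL (Fin n) (AdeleRing (𝓞 K) K)) :
        Matrix (Fin n) (Fin n) (AdeleRing (𝓞 K) K)) := by
  funext j
  rw [Matrix.GeneralLinearGroup.coe_scalar, Matrix.scalar_apply, Matrix.vecMul_diagonal, Pi.smul_apply,
    smul_eq_mul, mul_comm]

/-- Multiplication of a column vector by the scalar matrix `a 1_n` is `η ↦ a η`. [folklore] -/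
theorem scalar_mulVec_eq_smul (a : (AdeleRing (𝓞 K) K)ˣ) (η : Fin n → AdeleRing (𝓞 K) K) :
    ((Matrix.GeneralLinearGroup.scalar (Fin n) a : GL (Fin n) (AdeleRing (𝓞 K) K)) :
        Matrix (Fin n) (Fin n) (AdeleRing (𝓞 K) K)) *ᵥ η = (a : AdeleRing (𝓞 K) K) • η := by
  funext j
  rw [Matrix.GeneralLinearGroup.coe_scalar, Matrix.scalar_apply, Matrix.mulVec_diagonal, Pi.smul_apply,
    smul_eq_mul]

/-- `|det (a 1_n)|_𝔸 = |a|ⁿ`. [folklore] -/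
theorem adelicAbsDet_scalar (a : (AdeleRing (𝓞 K) K)ˣ) :
    adelicAbsDet n K (Matrix.GeneralLinearGroup.scalar (Fin n) a) = IdeleClassGroup.ideleNorm K a ^ n := by
  rw [adelicAbsDet_apply, Matrix.GeneralLinearGroup.det_scalar, Fintype.card_fin, map_pow]

end Parts

/-! ### `𝒮(𝔸_Kⁿ)` is stable under `Φ ↦ Φ(· g)` -/

section SchwartzBruhat

variable {n : ℕ} {K : Type} [Field K] [NumberField K]

/-- **The Schwartz–Bruhat generators are stable under `x ↦ x g`**: for a factorizable
`Φ = Φ_∞ ⊗ Φ_f` on `𝔸_Kⁿ` and `g ∈ GL_n(𝔸_K)`, `x ↦ Φ(x g)` is again factorizable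
(`Φ_∞ ∘ (y ↦ y g_∞)` is Schwartz, `Φ_f ∘ (y ↦ y g_f)` is locally constant of compact support).
[folklore] -/
theorem IsFactorizablePiSchwartzBruhat.comp_vecMul {Φ : (Fin n → AdeleRing (𝓞 K) K) → ℂ}
    (h : IsFactorizablePiSchwartzBruhat K (Fin n) Φ) (g : GL (Fin n) (AdeleRing (𝓞 K) K)) :
    IsFactorizablePiSchwartzBruhat K (Fin n) fun x =>
      Φ (x ᵥ* (g : Matrix (Fin n) (Fin n) (AdeleRing (𝓞 K) K))) := by
  obtain ⟨Φinf, Φfin, hfin, rfl⟩ := h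
  refine ⟨SchwartzMap.compCLMOfContinuousLinearEquiv ℂ (vecArchCLE n K (GLn.archUnit n K g)) Φinf,
    fun y => Φfin (vecFinHomeomorph (GLn.finUnit n K g) y), ?_, ?_⟩
  · obtain ⟨hlc, hcs⟩ := (mem_schwartzBruhat_iff).1 hfin
    exact (mem_schwartzBruhat_iff).2
      ⟨hlc.comp_continuous (vecFinHomeomorph _).continuous, hcs.comp_homeomorph _⟩
  · funext x
    dsimp only
    rw [SchwartzMap.compCLMOfContinuousLinearEquiv_apply, Function.comp_apply, vecArchCLE_apply,
      GLn.coe_archUnit, piArch_vecMul, piFinite_vecMul]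
    rfl

/-- **`𝒮(𝔸_Kⁿ)` is stable under `Φ ↦ Φ(· g)`**, `g ∈ GL_n(𝔸_K)` (Jacquet–Shalika (1981), §4:
`E(g, Φ; s)` is built from `Φ(· g)`; Godement–Jacquet, LNM 260, §11 for matrices). [folklore] -/
theorem comp_vecMul_mem_piSchwartzBruhat {Φ : (Fin n → AdeleRing (𝓞 K) K) → ℂ}
    (hΦ : Φ ∈ piSchwartzBruhat K (Fin n)) (g : GL (Fin n) (AdeleRing (𝓞 K) K)) :
    (fun x => Φ (x ᵥ* (g : Matrix (Fin n) (Fin n) (AdeleRing (𝓞 K) K)))) ∈ piSchwartzBruhat K (Fin n) := by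
  induction hΦ using Submodule.span_induction with
  | mem Φ h => exact mem_piSchwartzBruhat (h.comp_vecMul g)
  | zero => exact zero_mem _
  | add Φ Ψ _ _ ihΦ ihΨ => exact add_mem ihΦ ihΨ
  | smul c Φ _ ih => exact Submodule.smul_mem _ c ih

/-- **`𝒮(𝔸_Kⁿ)` is stable under dilations `Φ ↦ Φ(a ·)` by ideles** (Tate's `f(𝔞 𝔵)`). [folklore] -/
theorem comp_smul_mem_piSchwartzBruhat {Φ : (Fin n → AdeleRing (𝓞 K) K) → ℂ}
    (hΦ : Φ ∈ piSchwartzBruhat K (Fin n)) (a : (AdeleRing (𝓞 K) K)ˣ) :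
    (fun x => Φ ((a : AdeleRing (𝓞 K) K) • x)) ∈ piSchwartzBruhat K (Fin n) := by
  have h := comp_vecMul_mem_piSchwartzBruhat hΦ (Matrix.GeneralLinearGroup.scalar (Fin n) a)
  simp_rw [← units_smul_eq_vecMul_scalar] at h
  exact h

end SchwartzBruhat

/-! ### The module of `x ↦ x g` on `𝔸_Kⁿ` is `|det g|_𝔸` -/

section Module

attribute [local instance] secondCountableTopology_adeleRing locallyCompactSpace_adeleRing'

variable {n : ℕ} {K : Type} [Field K] [NumberField K]
  [MeasurableSpace (AdeleRing (𝓞 K) K)] [BorelSpace (AdeleRing (𝓞 K) K)]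

variable (K) in
omit [MeasurableSpace (AdeleRing (𝓞 K) K)] [BorelSpace (AdeleRing (𝓞 K) K)] in
/-- `𝔸_K` is Hausdorff (product of Hausdorff factors; a private copy of `t2Space_adeleRing` of
`QuaternionAlgebraAdelicProofs`, not imported here). [folklore] -/
private theorem t2Space_adeleRing_rows : T2Space (AdeleRing (𝓞 K) K) := by
  haveI : T2Space (FiniteAdeleRing (𝓞 K) K) := inferInstanceAs <| T2Space
    (Πʳ w : HeightOneSpectrum (𝓞 K), [w.adicCompletion K, w.adicCompletionIntegers K])
  haveI : T2Space (InfiniteAdeleRing K) :=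
    inferInstanceAs <| T2Space ((w : InfinitePlace K) → w.Completion)
  exact inferInstanceAs <| T2Space (InfiniteAdeleRing K × FiniteAdeleRing (𝓞 K) K)

omit [MeasurableSpace (AdeleRing (𝓞 K) K)] [BorelSpace (AdeleRing (𝓞 K) K)] in
/-- The matrices all of whose rows lie in prescribed sets: the box `∏ᵢ Aᵢ ⊆ (𝔸_Kⁿ)ⁿ = M_n(𝔸_K)`.
[folklore] -/
theorem setOf_forall_row_mem_eq_pi (A : Fin n → Set (Fin n → AdeleRing (𝓞 K) K)) :
    ({X : Matrix (Fin n) (Fin n) (AdeleRing (𝓞 K) K) | ∀ i, X i ∈ A i} :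
        Set (Fin n → Fin n → AdeleRing (𝓞 K) K)) = Set.univ.pi A := by
  ext X
  exact Set.mem_univ_pi.symm

omit [MeasurableSpace (AdeleRing (𝓞 K) K)] [BorelSpace (AdeleRing (𝓞 K) K)] in
/-- Right multiplication of matrices acts row by row: `(X g) i = (X i) g`, so the right translate of
a box of rows is the box of the translated rows. [folklore] -/
theorem op_smul_setOf_forall_row_mem (g : GL (Fin n) (AdeleRing (𝓞 K) K))
    (A : Fin n → Set (Fin n → AdeleRing (𝓞 K) K)) :
    Units.opEquiv.symm (MulOpposite.op g) • {X : Matrix (Fin n) (Fin n) (AdeleRing (𝓞 K) K) | ∀ i, X i ∈ A i} =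
      {X : Matrix (Fin n) (Fin n) (AdeleRing (𝓞 K) K) | ∀ i, X i ∈ vecMulAddEquiv g '' A i} := by
  ext X
  simp only [Set.mem_smul_set, Set.mem_setOf_eq, Set.mem_image]
  constructor
  · rintro ⟨Y, hY, rfl⟩ i
    exact ⟨Y i, hY i, rfl⟩
  · intro h
    choose Y hY hYX using h
    refine ⟨Matrix.of fun i => Y i, fun i => hY i, ?_⟩
    ext i j
    have h1 := congr_fun (hYX i) j
    rw [← h1]
    rfl

/-- **The module of `x ↦ x g` on `𝔸_Kⁿ` is `|det g|_𝔸`**: for every additive Haar measure `ν` on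
`𝔸_Kⁿ` and `g ∈ GL_n(𝔸_K)`, `(x ↦ x g)_* ν = |det g|_𝔸⁻¹ · ν` (Weil, *Basic Number Theory*,
Ch. IV §3, Cor. 1 of Prop. 3: the module of an automorphism of a vector space over a local field /
of `𝔸ⁿ` is `mod(det)`). Proof by the rows trick from the matrix case
`addHaar_matrix_op_smul_eq` (`MatrixAdeleModule`): on `M_n(𝔸_K) = (𝔸_Kⁿ)ⁿ` with `ν^{⊗n}`,
`X ↦ X g` acts row by row, so `ν(S)ⁿ = ν^{⊗n}((∏ T⁻¹S) g) = |det g|ⁿ (c ν(S))ⁿ` where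
`(x ↦ x g)_* ν = c ν` by uniqueness of Haar measure; hence `c |det g| = 1`.
[cite: WeilBNT1967, Ch. IV §3 Cor. 1] -/
theorem map_vecMul_eq_smul (ν : Measure (Fin n → AdeleRing (𝓞 K) K)) [ν.IsAddHaarMeasure]
    (g : GL (Fin n) (AdeleRing (𝓞 K) K)) :
    ν.map (vecMulAddEquiv g) = ((adelicAbsDet n K g⁻¹ : ℝ≥0) : ℝ≥0∞) • ν := by
  haveI : BorelSpace (Fin n → AdeleRing (𝓞 K) K) := Pi.borelSpace
  haveI : T2Space (AdeleRing (𝓞 K) K) := t2Space_adeleRing_rows K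
  have hmeas : Measurable (⇑(vecMulAddEquiv g) : (Fin n → AdeleRing (𝓞 K) K) → Fin n → AdeleRing (𝓞 K) K) :=
    (map_continuous (vecMulAddEquiv g)).measurable
  -- `(x ↦ x g)_* ν` is a Haar measure, hence `c • ν`
  set c : ℝ≥0 := (ν.map (vecMulAddEquiv g)).addHaarScalarFactor ν with hc_def
  have hc : ν.map (vecMulAddEquiv g) = c • ν := isAddLeftInvariant_eq_smul _ _
  rcases Nat.eq_zero_or_pos n with hn | hn
  · -- `n = 0`: everything is the identity
    subst hn
    have h1 : adelicAbsDet 0 K g⁻¹ = 1 := by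
      rw [adelicAbsDet_apply, show Matrix.GeneralLinearGroup.det g⁻¹ = 1 from by
        ext; simp, map_one]
    have hid : (⇑(vecMulAddEquiv g) : (Fin 0 → AdeleRing (𝓞 K) K) → Fin 0 → AdeleRing (𝓞 K) K) = id := by
      funext x; exact Subsingleton.elim _ _
    rw [h1, hid, Measure.map_id, ENNReal.coe_one, one_smul]
  -- the rows trick
  letI : MeasurableSpace (Matrix (Fin n) (Fin n) (AdeleRing (𝓞 K) K)) :=
    inferInstanceAs (MeasurableSpace (Fin n → Fin n → AdeleRing (𝓞 K) K))
  haveI : BorelSpace (Matrix (Fin n) (Fin n) (AdeleRing (𝓞 K) K)) :=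
    inferInstanceAs (BorelSpace (Fin n → Fin n → AdeleRing (𝓞 K) K))
  haveI : LocallyCompactSpace (Matrix (Fin n) (Fin n) (AdeleRing (𝓞 K) K)) :=
    inferInstanceAs (LocallyCompactSpace (Fin n → Fin n → AdeleRing (𝓞 K) K))
  haveI : SecondCountableTopology (Matrix (Fin n) (Fin n) (AdeleRing (𝓞 K) K)) :=
    inferInstanceAs (SecondCountableTopology (Fin n → Fin n → AdeleRing (𝓞 K) K))
  set P : Measure (Matrix (Fin n) (Fin n) (AdeleRing (𝓞 K) K)) :=
    Measure.pi fun _ : Fin n => ν with hP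
  haveI hPH : P.IsAddHaarMeasure := by
    rw [hP]; exact Measure.pi.isAddHaarMeasure _
  -- a compact set of positive finite measure, and the box of its preimages
  obtain ⟨S⟩ := (inferInstance : Nonempty (TopologicalSpace.PositiveCompacts (Fin n → AdeleRing (𝓞 K) K)))
  have hS0 : ν (S : Set (Fin n → AdeleRing (𝓞 K) K)) ≠ 0 :=
    (Measure.measure_pos_of_nonempty_interior ν S.interior_nonempty).ne'
  have hStop : ν (S : Set (Fin n → AdeleRing (𝓞 K) K)) ≠ ⊤ := S.isCompact.measure_lt_top.ne
  set B : Set (Matrix (Fin n) (Fin n) (AdeleRing (𝓞 K) K)) :=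
    {X | ∀ i, X i ∈ vecMulAddEquiv g ⁻¹' (S : Set (Fin n → AdeleRing (𝓞 K) K))} with hB_def
  have hB : Units.opEquiv.symm (MulOpposite.op g) • B =
      {X : Matrix (Fin n) (Fin n) (AdeleRing (𝓞 K) K) | ∀ i, X i ∈ (S : Set (Fin n → AdeleRing (𝓞 K) K))} := by
    rw [hB_def, op_smul_setOf_forall_row_mem]
    simp only [Set.image_preimage_eq _ (vecMulAddEquiv g).surjective]
  have hPB : P B = ν (vecMulAddEquiv g ⁻¹' (S : Set (Fin n → AdeleRing (𝓞 K) K))) ^ n := by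
    rw [hP, hB_def]
    change Measure.pi (fun _ : Fin n => ν)
      ({X : Matrix (Fin n) (Fin n) (AdeleRing (𝓞 K) K) | ∀ i, X i ∈ vecMulAddEquiv g ⁻¹' (S : Set _)} :
        Set (Fin n → Fin n → AdeleRing (𝓞 K) K)) = _
    rw [setOf_forall_row_mem_eq_pi, Measure.pi_pi, Finset.prod_const, Finset.card_univ, Fintype.card_fin]
  have hPS : P {X : Matrix (Fin n) (Fin n) (AdeleRing (𝓞 K) K) | ∀ i, X i ∈ (S : Set (Fin n → AdeleRing (𝓞 K) K))} =
      ν (S : Set (Fin n → AdeleRing (𝓞 K) K)) ^ n := by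
    rw [hP]
    change Measure.pi (fun _ : Fin n => ν)
      ({X : Matrix (Fin n) (Fin n) (AdeleRing (𝓞 K) K) | ∀ i, X i ∈ (S : Set _)} :
        Set (Fin n → Fin n → AdeleRing (𝓞 K) K)) = _
    rw [setOf_forall_row_mem_eq_pi, Measure.pi_pi, Finset.prod_const, Finset.card_univ, Fintype.card_fin]
  -- the matrix module
  have h1 := addHaar_matrix_op_smul_eq n K P g B
  rw [hB, hPS, hPB] at h1
  -- `ν(T⁻¹ S) = c ν(S)`
  have h2 : ν (vecMulAddEquiv g ⁻¹' (S : Set (Fin n → AdeleRing (𝓞 K) K))) =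
      c * ν (S : Set (Fin n → AdeleRing (𝓞 K) K)) := by
    rw [← Measure.map_apply hmeas S.isCompact.measurableSet, hc, Measure.coe_nnreal_smul_apply]
  rw [h2, mul_pow, ← mul_assoc, ENNReal.coe_pow, ← mul_pow] at h1
  -- `(|det g| c)ⁿ = 1`
  have h3 : ((adelicAbsDet n K g : ℝ≥0∞) * c) ^ n = 1 ^ n := by
    have h4 : (1 : ℝ≥0∞) ^ n * ν (S : Set (Fin n → AdeleRing (𝓞 K) K)) ^ n =
        ((adelicAbsDet n K g : ℝ≥0∞) * c) ^ n * ν (S : Set (Fin n → AdeleRing (𝓞 K) K)) ^ n := by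
      rw [one_pow, one_mul]; exact h1
    exact ((ENNReal.mul_left_inj (pow_ne_zero _ hS0) (ENNReal.pow_ne_top hStop)).1 h4).symm
  have h5 : (adelicAbsDet n K g : ℝ≥0∞) * c = 1 := (ENNReal.pow_right_strictMono hn.ne').injective h3
  have h6 : adelicAbsDet n K g * c = 1 := by exact_mod_cast h5
  have h7 : c = adelicAbsDet n K g⁻¹ := by
    have hinv : adelicAbsDet n K g⁻¹ * adelicAbsDet n K g = 1 := by rw [← map_mul, inv_mul_cancel, map_one]
    rw [eq_inv_of_mul_eq_one_left hinv]
    exact (eq_inv_of_mul_eq_one_right h6)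
  rw [hc, h7]
  ext A hA
  rw [Measure.coe_nnreal_smul_apply, Measure.smul_apply, smul_eq_mul]

/-- `vol(S g) = |det g|_𝔸 vol(S)` for Borel `S ⊆ 𝔸_Kⁿ`. [cite: WeilBNT1967, Ch. IV §3 Cor. 1] -/
theorem addHaar_preimage_vecMul (ν : Measure (Fin n → AdeleRing (𝓞 K) K)) [ν.IsAddHaarMeasure]
    (g : GL (Fin n) (AdeleRing (𝓞 K) K)) {S : Set (Fin n → AdeleRing (𝓞 K) K)} (hS : MeasurableSet S) :
    ν (vecMulAddEquiv g ⁻¹' S) = ((adelicAbsDet n K g⁻¹ : ℝ≥0) : ℝ≥0∞) * ν S := by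
  haveI : BorelSpace (Fin n → AdeleRing (𝓞 K) K) := Pi.borelSpace
  have hmeas : Measurable (⇑(vecMulAddEquiv g) : (Fin n → AdeleRing (𝓞 K) K) → Fin n → AdeleRing (𝓞 K) K) :=
    (map_continuous (vecMulAddEquiv g)).measurable
  rw [← Measure.map_apply hmeas hS, map_vecMul_eq_smul, Measure.smul_apply, smul_eq_mul]

/-- **Substitution `x ↦ x g` in integrals over `𝔸_Kⁿ`**: `∫ Φ(x g) dν(x) = |det g|_𝔸⁻¹ ∫ Φ dν` for
every additive Haar measure `ν` (and every `Φ`, both sides being junk together). [folklore] -/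
theorem integral_comp_vecMul {E : Type*} [NormedAddCommGroup E] [NormedSpace ℝ E]
    (ν : Measure (Fin n → AdeleRing (𝓞 K) K)) [ν.IsAddHaarMeasure] (Φ : (Fin n → AdeleRing (𝓞 K) K) → E)
    (g : GL (Fin n) (AdeleRing (𝓞 K) K)) :
    ∫ x, Φ (x ᵥ* (g : Matrix (Fin n) (Fin n) (AdeleRing (𝓞 K) K))) ∂ν =
      ((adelicAbsDet n K g⁻¹ : ℝ≥0) : ℝ) • ∫ x, Φ x ∂ν := by
  haveI : BorelSpace (Fin n → AdeleRing (𝓞 K) K) := Pi.borelSpace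
  rw [show (fun x => Φ (x ᵥ* (g : Matrix (Fin n) (Fin n) (AdeleRing (𝓞 K) K)))) =
      fun x => Φ ((vecMulAddEquiv g).toHomeomorph.toMeasurableEquiv x) by
        funext x; rw [Homeomorph.toMeasurableEquiv_coe]; rfl,
    ← integral_map_equiv, Homeomorph.toMeasurableEquiv_coe]
  change ∫ y, Φ y ∂(ν.map (vecMulAddEquiv g)) = _
  rw [map_vecMul_eq_smul, integral_smul_measure, ENNReal.coe_toReal]

/-- Integrability of `x ↦ Φ(x g)` is integrability of `Φ`. [folklore] -/
theorem integrable_comp_vecMul_iff {E : Type*} [NormedAddCommGroup E]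
    (ν : Measure (Fin n → AdeleRing (𝓞 K) K)) [ν.IsAddHaarMeasure] (Φ : (Fin n → AdeleRing (𝓞 K) K) → E)
    (g : GL (Fin n) (AdeleRing (𝓞 K) K)) :
    Integrable (fun x => Φ (x ᵥ* (g : Matrix (Fin n) (Fin n) (AdeleRing (𝓞 K) K)))) ν ↔ Integrable Φ ν := by
  haveI : BorelSpace (Fin n → AdeleRing (𝓞 K) K) := Pi.borelSpace
  have hne : ((adelicAbsDet n K g⁻¹ : ℝ≥0) : ℝ≥0∞) ≠ 0 := by
    have h : adelicAbsDet n K g⁻¹ ≠ 0 := by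
      rw [adelicAbsDet_apply]; exact ideleNorm_ne_zero _
    exact_mod_cast h
  rw [show (fun x => Φ (x ᵥ* (g : Matrix (Fin n) (Fin n) (AdeleRing (𝓞 K) K)))) =
      fun x => Φ ((vecMulAddEquiv g).toHomeomorph.toMeasurableEquiv x) by
        funext x; rw [Homeomorph.toMeasurableEquiv_coe]; rfl,
    show (fun x => Φ ((vecMulAddEquiv g).toHomeomorph.toMeasurableEquiv x)) =
      Φ ∘ (vecMulAddEquiv g).toHomeomorph.toMeasurableEquiv from rfl,
    ← integrable_map_equiv, Homeomorph.toMeasurableEquiv_coe]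
  change Integrable Φ (ν.map (vecMulAddEquiv g)) ↔ _
  rw [map_vecMul_eq_smul, integrable_smul_measure hne ENNReal.coe_ne_top]

/-- **Substitution `x ↦ a x` (a scalar idele) in integrals over `𝔸_Kⁿ`**:
`∫ Φ(a x) dν(x) = |a|^{-n} ∫ Φ dν` — Tate's `∫ f(𝔞𝔵) d𝔵 = |𝔞|⁻¹ ∫ f` in `n` variables. [folklore] -/
theorem integral_comp_smul {E : Type*} [NormedAddCommGroup E] [NormedSpace ℝ E]
    (ν : Measure (Fin n → AdeleRing (𝓞 K) K)) [ν.IsAddHaarMeasure] (Φ : (Fin n → AdeleRing (𝓞 K) K) → E)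
    (a : (AdeleRing (𝓞 K) K)ˣ) :
    ∫ x, Φ ((a : AdeleRing (𝓞 K) K) • x) ∂ν =
      ((IdeleClassGroup.ideleNorm K a⁻¹ ^ n : ℝ≥0) : ℝ) • ∫ x, Φ x ∂ν := by
  simp_rw [units_smul_eq_vecMul_scalar]
  rw [integral_comp_vecMul, ← map_inv, adelicAbsDet_scalar]

end Module

/-! ### The Fourier transform of `x ↦ Φ(x g)` -/

section Fourier

attribute [local instance] secondCountableTopology_adeleRing locallyCompactSpace_adeleRing'

variable {n : ℕ} {K : Type} [Field K] [NumberField K]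
  [MeasurableSpace (AdeleRing (𝓞 K) K)] [BorelSpace (AdeleRing (𝓞 K) K)]
  (ν : Measure (Fin n → AdeleRing (𝓞 K) K)) [ν.IsAddHaarMeasure]

omit [MeasurableSpace (AdeleRing (𝓞 K) K)] [BorelSpace (AdeleRing (𝓞 K) K)] in
/-- The pairing of `adelicPiFourier` is the dot product: `∑ η_i v_i = η ⬝ v`. [folklore] -/
theorem sum_mul_eq_dotProduct (η v : Fin n → AdeleRing (𝓞 K) K) : ∑ i, η i * v i = η ⬝ᵥ v := rfl

omit [MeasurableSpace (AdeleRing (𝓞 K) K)] [BorelSpace (AdeleRing (𝓞 K) K)] in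
/-- `(g⁻¹ η) ⬝ (x g) = η ⬝ x`: the adjoint of `x ↦ x g` for the dot product is `η ↦ g η`. [folklore] -/
theorem dotProduct_inv_mulVec_vecMul (g : GL (Fin n) (AdeleRing (𝓞 K) K)) (η x : Fin n → AdeleRing (𝓞 K) K) :
    (((g⁻¹ : GL (Fin n) (AdeleRing (𝓞 K) K)) : Matrix (Fin n) (Fin n) (AdeleRing (𝓞 K) K)) *ᵥ η) ⬝ᵥ
        (x ᵥ* (g : Matrix (Fin n) (Fin n) (AdeleRing (𝓞 K) K))) = η ⬝ᵥ x := by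
  rw [dotProduct_comm, Matrix.dotProduct_mulVec, Matrix.vecMul_vecMul, ← Matrix.GeneralLinearGroup.coe_mul,
    mul_inv_cancel, Matrix.GeneralLinearGroup.coe_one, Matrix.vecMul_one, dotProduct_comm]

/-- **The Fourier transform of `x ↦ Φ(x g)`**: for `g ∈ GL_n(𝔸_K)` and every additive Haar measure
`ν` on `𝔸_Kⁿ`, `(Φ(· g))^(η) = |det g|_𝔸⁻¹ Φ̂(g⁻¹ η)` (column vector `g⁻¹ η`; substitute
`y = x g`, `dν(x) = |det g|⁻¹ dν(y)`, `η ⬝ (y g⁻¹) = (g⁻¹ η) ⬝ y`). The vector analogue of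
`adelicMatrixFourier_comp_mul_mul`; Tate's "replace `f(x)` by `f(αx)`" (Thm. 4.2.1) for `n = 1`.
[folklore] -/
theorem adelicPiFourier_comp_vecMul (Φ : (Fin n → AdeleRing (𝓞 K) K) → ℂ)
    (g : GL (Fin n) (AdeleRing (𝓞 K) K)) (η : Fin n → AdeleRing (𝓞 K) K) :
    adelicPiFourier K (Fin n) ν (fun x => Φ (x ᵥ* (g : Matrix (Fin n) (Fin n) (AdeleRing (𝓞 K) K)))) η =
      ((adelicAbsDet n K g⁻¹ : ℝ≥0) : ℂ) *
        adelicPiFourier K (Fin n) ν Φ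
          (((g⁻¹ : GL (Fin n) (AdeleRing (𝓞 K) K)) : Matrix (Fin n) (Fin n) (AdeleRing (𝓞 K) K)) *ᵥ η) := by
  set η' : Fin n → AdeleRing (𝓞 K) K :=
    ((g⁻¹ : GL (Fin n) (AdeleRing (𝓞 K) K)) : Matrix (Fin n) (Fin n) (AdeleRing (𝓞 K) K)) *ᵥ η with hη'
  set G : (Fin n → AdeleRing (𝓞 K) K) → ℂ := fun y =>
    Φ y * (adeleAddChar K (∑ i, η' i * y i) : ℂ) with hG
  have hcomp : (fun x => Φ (x ᵥ* (g : Matrix (Fin n) (Fin n) (AdeleRing (𝓞 K) K))) *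
      (adeleAddChar K (∑ i, η i * x i) : ℂ)) =
      fun x => G (x ᵥ* (g : Matrix (Fin n) (Fin n) (AdeleRing (𝓞 K) K))) := by
    funext x
    simp only [hG]
    rw [sum_mul_eq_dotProduct, sum_mul_eq_dotProduct, hη', dotProduct_inv_mulVec_vecMul]
  rw [adelicPiFourier_apply, adelicPiFourier_apply, hcomp, integral_comp_vecMul ν G g]
  rw [Complex.real_smul, hG]

/-- **The Fourier transform of a dilate** `x ↦ Φ(a x)`, `a ∈ 𝔸_Kˣ`:
`(Φ(a ·))^(η) = |a|^{-n} Φ̂(a⁻¹ η)` — Tate's "if we replace `f(x)` by `f(αx)`" (Thm. 4.2.1) in `n`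
variables; the input of the functional equation of the theta series `Θ_Φ(a) = Σ_{ξ ∈ Kⁿ} Φ(a ξ)`.
[cite: CasselsFrohlichANT1967, Ch. XV Thm. 4.2.1] -/
theorem adelicPiFourier_comp_smul (Φ : (Fin n → AdeleRing (𝓞 K) K) → ℂ) (a : (AdeleRing (𝓞 K) K)ˣ)
    (η : Fin n → AdeleRing (𝓞 K) K) :
    adelicPiFourier K (Fin n) ν (fun x => Φ ((a : AdeleRing (𝓞 K) K) • x)) η =
      ((IdeleClassGroup.ideleNorm K a⁻¹ ^ n : ℝ≥0) : ℂ) *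
        adelicPiFourier K (Fin n) ν Φ (((a⁻¹ : (AdeleRing (𝓞 K) K)ˣ) : AdeleRing (𝓞 K) K) • η) := by
  have h := adelicPiFourier_comp_vecMul ν Φ (Matrix.GeneralLinearGroup.scalar (Fin n) a) η
  simp_rw [← units_smul_eq_vecMul_scalar] at h
  rw [h, ← map_inv, adelicAbsDet_scalar, scalar_mulVec_eq_smul]

end Fourier


end Literature.NumberTheory.Automorphic
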